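import Mathlib
import Literature.Geometry.Symplectic.JHolomorphicMap
import Summits.SmoothPoincare4.SmoothPoincare4.Theorems.SullivanDualTameOrBrodyR4PencilDefs

/-!
# Embeddedness persists under `C¹`-small perturbation (stub `helper_embeddingPersists`, Sketch)

Crux `stmt-SmoothPoincare4-7826` (`TameOrBrodyR4`), line `Sketch`, in the vocabulary of
`Theorems/SullivanDualTameOrBrodyR4PencilDefs.lean`. A pencil member `u₀` (`IsPencilMember`) is
in particular a `C^∞` injective immersion `ℂ → ℝ⁴`. If `u : ℂ → ℝ⁴` is `C¹`, is `δ`-close to `u₀`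
in `C¹` on the closed disc `‖ξ‖ ≤ ρ`, takes every far value `c` (`|c| > 2R`) of `P ∘ u` at exactly
one parameter with `d(P ∘ u)` invertible wherever `|P ∘ u| > 2R`, and has `|P (u ξ)| > 2R` for
`‖ξ‖ ≥ ρ`, then for `δ > 0` small enough (depending on `u₀` and `ρ` only) `u` is again an
injective immersion. This is the elementary compact-disc form of "embeddings are `C¹`-open"
(Hirsch, *Differential Topology* (1976), Ch. 2, Thm 1.4); pure finite-dimensional analysis:

* `EmbeddingPersists.exists_fderiv_lower_bound` — `(ξ, ζ) ↦ ‖du₀(ξ) ζ‖` is continuous and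
  positive on the compact set `closedBall 0 ρ ×ˢ sphere 0 1`, hence `≥ m > 0`:
  `m ‖v‖ ≤ ‖du₀(ξ) v‖` on the disc. So `‖du(ξ) - du₀(ξ)‖ ≤ δ < m` keeps `du(ξ)` injective on the
  disc; off the disc `d(P ∘ u)(ξ) = P ∘ du(ξ)` is bijective, so `du(ξ)` is injective.
* `EmbeddingPersists.exists_near_lower_bound` — uniform continuity of `du₀` on the disc and the
  mean value inequality against the fixed linear map `du₀(ξ')`
  (`Convex.norm_image_sub_le_of_norm_fderiv_le'`) give `(m / 2) ‖ξ - ξ'‖ ≤ ‖u₀ ξ - u₀ ξ'‖` for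
  `ξ, ξ'` in the disc with `dist ξ ξ' < η`.
* `EmbeddingPersists.exists_far_lower_bound` — on the compact part `{η ≤ dist ξ ξ'}` of the disc
  squared the continuous positive function `‖u₀ ξ - u₀ ξ'‖` is `≥ μ > 0`.
* With `δ = min (m / 4) (μ / 4)`: if `u ξ = u ξ'` with both points in the disc, the mean value
  inequality for `u - u₀` (`‖d(u - u₀)‖ ≤ δ` on the convex disc) gives
  `‖u₀ ξ - u₀ ξ'‖ ≤ δ ‖ξ - ξ'‖`, and the `C⁰`-closeness gives `‖u₀ ξ - u₀ ξ'‖ ≤ 2δ`; one of the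
  two lower bounds then forces `ξ = ξ'`. If one of the points is off the disc, the common value
  `c = P (u ξ) = P (u ξ')` is far and is taken only once.
-/

-- the registered namespace `Summit.SmoothPoincare4.SmoothPoincare4.…` repeats a component
set_option linter.dupNamespace false

noncomputable section

open scoped ContDiff Topology
open Filter Set Metric Literature.Geometry.Symplectic

namespace Summit.SmoothPoincare4.SmoothPoincare4.Cruxes.TameOrBrodyR4.Sketch

/-- Local notation for the model space `ℝ⁴ = EuclideanSpace ℝ (Fin 4)`. -/
local notation "E4" => EuclideanSpace ℝ (Fin 4)

namespace EmbeddingPersists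

/-- **Uniform immersion bound on a compact set.** If `du₀` is continuous and injective at every
point, then on a compact `K ⊆ ℂ` there is `m > 0` with `m ‖v‖ ≤ ‖du₀(ξ) v‖` for `ξ ∈ K`: the
continuous positive function `(ξ, ζ) ↦ ‖du₀(ξ) ζ‖` has a positive lower bound on the compact set
`K ×ˢ sphere 0 1` (`IsCompact.exists_forall_le'`), and one rescales. -/
theorem exists_fderiv_lower_bound {u₀ : ℂ → E4} (hc : Continuous (fderiv ℝ u₀))
    (himm : ∀ ξ, Function.Injective (fderiv ℝ u₀ ξ)) {K : Set ℂ} (hK : IsCompact K) :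
    ∃ m > (0 : ℝ), ∀ ξ ∈ K, ∀ v : ℂ, m * ‖v‖ ≤ ‖fderiv ℝ u₀ ξ v‖ := by
  have hS : IsCompact (K ×ˢ sphere (0 : ℂ) 1) := hK.prod (isCompact_sphere 0 1)
  have hF : Continuous fun p : ℂ × ℂ => ‖fderiv ℝ u₀ p.1 p.2‖ :=
    ((hc.comp continuous_fst).clm_apply continuous_snd).norm
  have hpos : ∀ p ∈ K ×ˢ sphere (0 : ℂ) 1, (0 : ℝ) < ‖fderiv ℝ u₀ p.1 p.2‖ := by
    intro p hp
    have hp2 : ‖p.2‖ = 1 := mem_sphere_zero_iff_norm.1 hp.2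
    refine norm_pos_iff.2 fun h0 => ?_
    have h2 : p.2 = 0 := himm p.1 (by rw [h0, map_zero])
    rw [h2, norm_zero] at hp2
    exact zero_ne_one hp2
  obtain ⟨m, hm, hmle⟩ := hS.exists_forall_le' hF.continuousOn hpos
  refine ⟨m, hm, fun ξ hξ v => ?_⟩
  rcases eq_or_ne v 0 with rfl | hv
  · simp
  have hvn : 0 < ‖v‖ := norm_pos_iff.2 hv
  have hvn' : ‖v‖ ≠ 0 := hvn.ne'
  have hsph : (‖v‖⁻¹ : ℝ) • v ∈ sphere (0 : ℂ) 1 := by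
    rw [mem_sphere_zero_iff_norm, norm_smul, norm_inv, norm_norm, inv_mul_cancel₀ hvn']
  have h1 : m ≤ ‖fderiv ℝ u₀ ξ ((‖v‖⁻¹ : ℝ) • v)‖ :=
    hmle (ξ, (‖v‖⁻¹ : ℝ) • v) (mk_mem_prod hξ hsph)
  rw [map_smul, norm_smul, norm_inv, norm_norm] at h1
  calc m * ‖v‖ ≤ ‖v‖⁻¹ * ‖fderiv ℝ u₀ ξ v‖ * ‖v‖ := by gcongr
    _ = ‖fderiv ℝ u₀ ξ v‖ := by field_simp

/-- **Near-diagonal lower bound.** On the closed disc `D = closedBall 0 ρ`: if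
`m ‖v‖ ≤ ‖du₀(ξ) v‖` for `ξ ∈ D` and `du₀` is continuous, then there is `η > 0` with
`(m / 2) ‖ξ - ξ'‖ ≤ ‖u₀ ξ - u₀ ξ'‖` for `ξ, ξ' ∈ D`, `dist ξ ξ' < η` (uniform continuity of `du₀`
on `D` and the mean value inequality against the fixed linear map `du₀(ξ')` on the convex set
`D ∩ ball ξ' η`). -/
theorem exists_near_lower_bound {u₀ : ℂ → E4} (hd : Differentiable ℝ u₀)
    (hc : Continuous (fderiv ℝ u₀)) {ρ m : ℝ} (hm : 0 < m)
    (hlow : ∀ ξ ∈ closedBall (0 : ℂ) ρ, ∀ v : ℂ, m * ‖v‖ ≤ ‖fderiv ℝ u₀ ξ v‖) :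
    ∃ η > (0 : ℝ), ∀ ξ ∈ closedBall (0 : ℂ) ρ, ∀ ξ' ∈ closedBall (0 : ℂ) ρ, dist ξ ξ' < η →
      m / 2 * ‖ξ - ξ'‖ ≤ ‖u₀ ξ - u₀ ξ'‖ := by
  obtain ⟨η, hη, hηc⟩ := Metric.uniformContinuousOn_iff.1
    ((isCompact_closedBall (0 : ℂ) ρ).uniformContinuousOn_of_continuous hc.continuousOn)
    (m / 2) (half_pos hm)
  refine ⟨η, hη, fun ξ hξ ξ' hξ' hdist => ?_⟩
  set s : Set ℂ := closedBall (0 : ℂ) ρ ∩ ball ξ' η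
  have hs : Convex ℝ s := (convex_closedBall 0 ρ).inter (convex_ball ξ' η)
  have hbound : ∀ x ∈ s, ‖fderiv ℝ u₀ x - fderiv ℝ u₀ ξ'‖ ≤ m / 2 := fun x hx => by
    rw [← dist_eq_norm]
    exact (hηc x hx.1 ξ' hξ' (mem_ball.1 hx.2)).le
  have hmvt : ‖u₀ ξ - u₀ ξ' - fderiv ℝ u₀ ξ' (ξ - ξ')‖ ≤ m / 2 * ‖ξ - ξ'‖ :=
    hs.norm_image_sub_le_of_norm_fderiv_le' (fun x _ => hd x) hbound
      ⟨hξ', mem_ball_self hη⟩ ⟨hξ, mem_ball.2 hdist⟩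
  have h1 := hlow ξ' hξ' (ξ - ξ')
  have h2 := norm_le_norm_add_norm_sub (u₀ ξ - u₀ ξ') (fderiv ℝ u₀ ξ' (ξ - ξ'))
  linarith

/-- **Off-diagonal lower bound.** For a continuous injective `u₀` and `η > 0` there is `μ > 0`
with `μ ≤ ‖u₀ ξ - u₀ ξ'‖` whenever `ξ, ξ'` lie in the closed disc `closedBall 0 ρ` and
`η ≤ dist ξ ξ'` (a continuous positive function on a compact set). -/
theorem exists_far_lower_bound {u₀ : ℂ → E4} (hcu : Continuous u₀)
    (hinj : Function.Injective u₀) (ρ : ℝ) {η : ℝ} (hη : 0 < η) :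
    ∃ μ > (0 : ℝ), ∀ ξ ∈ closedBall (0 : ℂ) ρ, ∀ ξ' ∈ closedBall (0 : ℂ) ρ, η ≤ dist ξ ξ' →
      μ ≤ ‖u₀ ξ - u₀ ξ'‖ := by
  have hT : IsCompact (closedBall (0 : ℂ) ρ ×ˢ closedBall (0 : ℂ) ρ ∩ {p | η ≤ dist p.1 p.2}) :=
    ((isCompact_closedBall 0 ρ).prod (isCompact_closedBall 0 ρ)).inter_right
      (isClosed_le continuous_const continuous_dist)
  have hG : Continuous fun p : ℂ × ℂ => ‖u₀ p.1 - u₀ p.2‖ :=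
    ((hcu.comp continuous_fst).sub (hcu.comp continuous_snd)).norm
  have hpos : ∀ p ∈ closedBall (0 : ℂ) ρ ×ˢ closedBall (0 : ℂ) ρ ∩ {p | η ≤ dist p.1 p.2},
      (0 : ℝ) < ‖u₀ p.1 - u₀ p.2‖ := by
    intro p hp
    refine norm_pos_iff.2 (sub_ne_zero.2 fun heq => ?_)
    have hne : p.1 ≠ p.2 := dist_pos.1 (hη.trans_le hp.2)
    exact hne (hinj heq)
  obtain ⟨μ, hμ, hμle⟩ := hT.exists_forall_le' hG.continuousOn hpos
  exact ⟨μ, hμ, fun ξ hξ ξ' hξ' hdist => hμle (ξ, ξ') ⟨⟨hξ, hξ'⟩, hdist⟩⟩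

end EmbeddingPersists

/-- **Registered stub `helper_embeddingPersists`: injectivity and immersion persist under
`C¹`-small perturbation of a pencil member on a disc.** For a member `u₀` and a radius `ρ > 0`
there is `δ > 0` such that every `C¹` map `u : ℂ → ℝ⁴` which has the far-crossing properties
(every far value of `P ∘ u` taken exactly once, `d(P ∘ u)` bijective where `|P ∘ u| > 2R`), has
`|P (u ξ)| > 2R` for `‖ξ‖ ≥ ρ`, and is `δ`-close to `u₀` in `C¹` on `closedBall 0 ρ`, is an
injective immersion. -/
theorem helper_embeddingPersists (J : E4 → E4 →L[ℝ] E4) (R : ℝ) (P Q : E4 →L[ℝ] ℂ)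
    (eP eQ : ℂ →L[ℝ] E4) (hR : 0 < R) (hPQ : IsCoordFrame P Q eP eQ) (b₀ : ℂ) (u₀ : ℂ → E4)
    (hu₀ : IsPencilMember J R P Q b₀ u₀) (ρ : ℝ) (hρ : 0 < ρ) :
    ∃ δ > (0 : ℝ), ∀ u : ℂ → E4, ContDiff ℝ 1 u →
      (∀ c : ℂ, 2 * R < ‖c‖ → ∃! ξ, P (u ξ) = c) →
      (∀ ξ : ℂ, 2 * R < ‖P (u ξ)‖ → Function.Bijective (fderiv ℝ (fun ξ => P (u ξ)) ξ)) →
      (∀ ξ : ℂ, ρ ≤ ‖ξ‖ → 2 * R < ‖P (u ξ)‖) →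
      (∀ ξ ∈ Metric.closedBall (0 : ℂ) ρ,
        ‖u ξ - u₀ ξ‖ ≤ δ ∧ ‖fderiv ℝ u ξ - fderiv ℝ u₀ ξ‖ ≤ δ) →
      Function.Injective u ∧ ∀ ξ : ℂ, Function.Injective (fderiv ℝ u ξ) := by
  have _ := hR
  have _ := hPQ
  have _ := hρ
  obtain ⟨hu₀s, -, hu₀inj, hu₀imm, -, -, -, -⟩ := hu₀
  have hd₀ : Differentiable ℝ u₀ := hu₀s.differentiable (by simp)
  have hc₀ : Continuous (fderiv ℝ u₀) := hu₀s.continuous_fderiv (by simp)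
  -- the three constants of `u₀` on the disc
  obtain ⟨m, hm, hlow⟩ :=
    EmbeddingPersists.exists_fderiv_lower_bound hc₀ hu₀imm (isCompact_closedBall (0 : ℂ) ρ)
  obtain ⟨η, hη, hnear⟩ := EmbeddingPersists.exists_near_lower_bound hd₀ hc₀ hm hlow
  obtain ⟨μ, hμ, hfar⟩ := EmbeddingPersists.exists_far_lower_bound hu₀s.continuous hu₀inj ρ hη
  refine ⟨min (m / 4) (μ / 4), lt_min (by positivity) (by positivity), ?_⟩
  intro u hu huniq hbij hout hclose
  have hδm : min (m / 4) (μ / 4) ≤ m / 4 := min_le_left _ _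
  have hδμ : min (m / 4) (μ / 4) ≤ μ / 4 := min_le_right _ _
  set δ := min (m / 4) (μ / 4) with hδ_def
  have hδ0 : 0 ≤ δ := le_min (by positivity) (by positivity)
  have hd : Differentiable ℝ u := hu.differentiable (by simp)
  -- immersion
  have himm : ∀ ξ : ℂ, Function.Injective (fderiv ℝ u ξ) := by
    intro ξ
    by_cases hξ : ξ ∈ closedBall (0 : ℂ) ρ
    · -- on the disc: `‖du ξ - du₀ ξ‖ ≤ δ < m`
      intro v w hvw
      by_contra hne
      have hzn : 0 < ‖v - w‖ := norm_pos_iff.2 (sub_ne_zero.2 hne)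
      have h1 := hlow ξ hξ (v - w)
      have h2 : ‖fderiv ℝ u₀ ξ (v - w)‖ ≤ δ * ‖v - w‖ := by
        have h3 : fderiv ℝ u₀ ξ (v - w) = -((fderiv ℝ u ξ - fderiv ℝ u₀ ξ) (v - w)) := by
          rw [sub_apply, map_sub (fderiv ℝ u ξ), hvw, sub_self, zero_sub, neg_neg]
        rw [h3, norm_neg]
        exact ((fderiv ℝ u ξ - fderiv ℝ u₀ ξ).le_opNorm _).trans
          (mul_le_mul_of_nonneg_right (hclose ξ hξ).2 (norm_nonneg _))
      nlinarith [mul_pos hm hzn, mul_le_mul_of_nonneg_right hδm hzn.le]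
    · -- off the disc: `d(P ∘ u)(ξ) = P ∘ du(ξ)` is bijective
      have hρξ : ρ ≤ ‖ξ‖ := by
        rw [mem_closedBall_zero_iff, not_le] at hξ
        exact hξ.le
      have hP : HasFDerivAt (fun ξ => P (u ξ)) (P.comp (fderiv ℝ u ξ)) ξ :=
        P.hasFDerivAt.comp ξ (hd ξ).hasFDerivAt
      have h1 := (hbij ξ (hout ξ hρξ)).1
      rw [hP.fderiv, ContinuousLinearMap.coe_comp] at h1
      exact h1.of_comp
  refine ⟨?_, himm⟩
  -- injectivity: the mean value inequality for `u - u₀` on the convex disc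
  have hlip : ∀ ξ ∈ closedBall (0 : ℂ) ρ, ∀ ξ' ∈ closedBall (0 : ℂ) ρ,
      ‖(u ξ - u₀ ξ) - (u ξ' - u₀ ξ')‖ ≤ δ * ‖ξ - ξ'‖ := by
    intro ξ hξ ξ' hξ'
    refine (convex_closedBall (0 : ℂ) ρ).norm_image_sub_le_of_norm_fderiv_le
      (f := fun x => u x - u₀ x) (fun x _ => (hd x).sub (hd₀ x)) (fun x hx => ?_) hξ' hξ
    rw [fderiv_fun_sub (hd x) (hd₀ x)]
    exact (hclose x hx).2
  -- a coincidence with one point off the disc: the far value is taken once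
  have key : ∀ ζ ζ' : ℂ, u ζ = u ζ' → ρ ≤ ‖ζ‖ → ζ = ζ' := by
    intro ζ ζ' hζ hρζ
    obtain ⟨ξ₀, -, hξ₀⟩ := huniq (P (u ζ)) (hout ζ hρζ)
    exact (hξ₀ ζ rfl).trans (hξ₀ ζ' (by rw [hζ])).symm
  intro ξ ξ' heq
  by_contra hne
  by_cases hξ : ρ ≤ ‖ξ‖
  · exact hne (key ξ ξ' heq hξ)
  by_cases hξ' : ρ ≤ ‖ξ'‖
  · exact hne (key ξ' ξ heq.symm hξ').symm
  have hξD : ξ ∈ closedBall (0 : ℂ) ρ := mem_closedBall_zero_iff.2 (not_le.1 hξ).le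
  have hξ'D : ξ' ∈ closedBall (0 : ℂ) ρ := mem_closedBall_zero_iff.2 (not_le.1 hξ').le
  have h0 : ‖u₀ ξ - u₀ ξ'‖ ≤ δ * ‖ξ - ξ'‖ := by
    have h := hlip ξ hξD ξ' hξ'D
    rw [heq] at h
    calc ‖u₀ ξ - u₀ ξ'‖ = ‖(u ξ' - u₀ ξ) - (u ξ' - u₀ ξ')‖ := by
          rw [← norm_neg (u₀ ξ - u₀ ξ')]
          congr 1
          abel
      _ ≤ δ * ‖ξ - ξ'‖ := h
  have h0' : ‖u₀ ξ - u₀ ξ'‖ ≤ 2 * δ := by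
    calc ‖u₀ ξ - u₀ ξ'‖ = ‖(u ξ' - u₀ ξ') - (u ξ - u₀ ξ)‖ := by
          rw [heq]
          congr 1
          abel
      _ ≤ ‖u ξ' - u₀ ξ'‖ + ‖u ξ - u₀ ξ‖ := norm_sub_le _ _
      _ ≤ δ + δ := add_le_add (hclose ξ' hξ'D).1 (hclose ξ hξD).1
      _ = 2 * δ := by ring
  have hpos : 0 < ‖ξ - ξ'‖ := norm_pos_iff.2 (sub_ne_zero.2 hne)
  by_cases hdist : dist ξ ξ' < η
  · have h1 := hnear ξ hξD ξ' hξ'D hdist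
    nlinarith [mul_pos hm hpos, mul_le_mul_of_nonneg_right hδm hpos.le]
  · have h1 := hfar ξ hξD ξ' hξ'D (not_lt.1 hdist)
    linarith
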